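import Mathlib
import Summits.MatrixMultiplication.MatrixMultiplication.Theorems.SnSubsetDichotomyHyperoctahedralThresholdStubPatternTwin

/-!
# `SnSubsetDichotomy.HyperoctahedralThreshold` — reflection-symmetric patterns give clean closed rung walks

Helper for crux `stmt-MatrixMultiplication-10883` (line `refutation-local-symmetry`, open core
`stub_poorRigidCore`; siege seat k20, variation "double counting on the colour classes").

Setting (the line's vocabulary): three involutions `μ 0, μ 1, μ 2` of `Fin n`; a colour word
`z : List (Fin 3)` acts on the right, `v · z = z.foldl (fun v c => μ c v) v`; the trajectory of a
fixed point `x` (`x · z = x`) is `t ↦ x · z.take t`, `t < ℓ = z.length`; its SELF-COINCIDENCE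
PATTERN is the relation `x · z.take s = x · z.take t` on positions.

The landed `stub_patternTwin` (p107640) extracts a clean closed rung walk from a LARGE family of fixed
points with identical patterns (twin type).  This file supplies:

* `patternRefl_cleanWalk` (reflection / loop–path–loop type, ONE fixed point).  If the cyclically reduced
  word `z` is REFLECTION-SYMMETRIC, `z[t] = z[(ℓ - t) % ℓ]` (equivalently `z = c :: g ++ c' :: g.reverse`,
  `reflForm_symm` — the colour word of a reflection closed walk `y·(u c u⁻¹) = y·(u' c' u'⁻¹)` of the
  pigeonhole supply on transported colour classes), then the mirror image `t ↦ x · z.take ((ℓ + 1 - t) % ℓ)`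
  of the trajectory of a fixed point `x` is again a trajectory of `z` (that of the fixed point `μ z[0] x`),
  the two never meet (forward determination would force `μ z[0] x = x`; `traj_ne_mirror`), and the rung
  walk `t ↦ {x · z.take t, x · z.take ((ℓ + 1 - t) % ℓ)}` is clean — pairwise equal-or-disjoint rungs —
  as soon as the pattern of `x` is invariant under the reflection `t ↦ (ℓ + 1 - t) % ℓ` of positions
  (and only then).  So a reflection structure is clean iff its base point and the neighbour across the
  axis edge have the same pattern: the reflection route's defects ARE pattern asymmetries, the currency
  of the rigidity hypothesis of `stub_poorRigidCore`.
* `patternPair_cleanWalk` (twin type, two-point form of `stub_patternTwin`): two fixed points of `z` with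
  identical patterns whose trajectories avoid `R` and never cross.

(The half-turn / Möbius companion is `patternHalfTurn_cleanWalk` in the sibling file
`SnSubsetDichotomyHyperoctahedralThresholdPatternHalfTurn`.)  All conclusions are in the exact output
format of the core (`k + 1 = ℓ` rungs `p i ≠ q i`, steps as sets, cyclically distinct colours, pairwise
equal-or-disjoint rungs, all points outside `R`), so every clean shape of `stub_extract` (cycle /
loop–path–loop / Möbius) has a pattern-level extraction lemma and the residual core can be phrased purely
in terms of fixed points of short words and their patterns.  Pure finite combinatorics; the proofs reuse
`GoodTwin.foldl_take_step` / `GoodTwin.cyclic_ne` of the landed `stub_goodTwin` (p99339). [folklore]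
-/

-- the project's summit namespace `Summit.MatrixMultiplication.MatrixMultiplication` repeats a component by design (D-0022)

set_option linter.dupNamespace false

namespace Summit.MatrixMultiplication.MatrixMultiplication.Theorems.HyperoctahedralThreshold

open Equiv

namespace PatternRefl

variable {n : ℕ}

/-- An involution letter undoes itself: `μ c (μ c v) = v`. [folklore] -/
theorem inv_apply_apply (μ : Fin 3 → Perm (Fin n)) (hinv : ∀ c, μ c * μ c = 1) (c : Fin 3)
    (v : Fin n) : μ c (μ c v) = v := by
  have h := congrArg (fun e : Perm (Fin n) => e v) (hinv c)
  simpa [Perm.mul_apply] using h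

/-- The first trajectory point is the neighbour along the first letter. [folklore] -/
theorem foldl_take_one (μ : Fin 3 → Perm (Fin n)) (z : List (Fin 3)) (hz : 0 < z.length)
    (v : Fin n) : (z.take 1).foldl (fun v c => μ c v) v = μ (z[0]'hz) v := by
  obtain ⟨c, w, rfl⟩ := List.exists_cons_of_length_pos hz
  simp

/-! ### The reflection of positions `σ t = (ℓ + 1 - t) % ℓ` -/

/-- `σ` is an involution on positions `< ℓ` (`ℓ ≥ 2`). [folklore] -/
theorem sigma_sigma {ℓ : ℕ} (hℓ : 2 ≤ ℓ) {s : ℕ} (hs : s < ℓ) :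
    (ℓ + 1 - (ℓ + 1 - s) % ℓ) % ℓ = s := by
  rcases Nat.lt_or_ge s 2 with h | h
  · interval_cases s
    · have h1 : (ℓ + 1) % ℓ = 1 := by
        rw [Nat.add_mod_left]; exact Nat.mod_eq_of_lt (by omega)
      rw [Nat.sub_zero, h1, Nat.add_sub_cancel, Nat.mod_self]
    · have h1 : (ℓ + 1 - 1) % ℓ = 0 := by simp
      rw [h1, Nat.sub_zero, Nat.add_mod_left]
      exact Nat.mod_eq_of_lt (by omega)
  · rw [Nat.mod_eq_of_lt (show ℓ + 1 - s < ℓ by omega),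
      show ℓ + 1 - (ℓ + 1 - s) = s by omega]
    exact Nat.mod_eq_of_lt hs

/-- The successor of a position reflects to the predecessor of its reflection:
`σ ((t + 1) % ℓ) = (ℓ - t) % ℓ`. [folklore] -/
theorem sigma_succ {ℓ : ℕ} {t : ℕ} (ht : t < ℓ) :
    (ℓ + 1 - (t + 1) % ℓ) % ℓ = (ℓ - t) % ℓ := by
  rcases (show t + 1 < ℓ ∨ t + 1 = ℓ by omega) with h | h
  · rw [Nat.mod_eq_of_lt h, show ℓ + 1 - (t + 1) = ℓ - t by omega]
  · rw [h, Nat.mod_self, Nat.sub_zero, Nat.add_mod_left, show ℓ - t = 1 by omega]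

/-- … and the reflection of a position is the successor of `(ℓ - t) % ℓ`:
`σ t = ((ℓ - t) % ℓ + 1) % ℓ`. [folklore] -/
theorem sigma_eq_succ {ℓ : ℕ} {t : ℕ} (ht : t < ℓ) :
    (ℓ + 1 - t) % ℓ = ((ℓ - t) % ℓ + 1) % ℓ := by
  rcases Nat.eq_zero_or_pos t with rfl | h
  · rw [Nat.sub_zero, Nat.sub_zero, Nat.mod_self, Nat.zero_add, Nat.add_mod_left]
  · rw [Nat.mod_eq_of_lt (show ℓ - t < ℓ by omega), show ℓ - t + 1 = ℓ + 1 - t by omega]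

/-- **Mirror step.**  For a reflection-symmetric word (`z[t] = z[(ℓ - t) % ℓ]`) and a fixed point `v`,
the mirrored trajectory `t ↦ v · z.take (σ t)` is again driven by the letters of `z`:
`μ z[t] (v · z.take (σ t)) = v · z.take (σ ((t + 1) % ℓ))`. [folklore] -/
theorem mirror_step (μ : Fin 3 → Perm (Fin n)) (hinv : ∀ c, μ c * μ c = 1) (z : List (Fin 3))
    (hlen : 2 ≤ z.length)
    (hsym : ∀ t (ht : t < z.length),
      z[t] = z[(z.length - t) % z.length]'(Nat.mod_lt _ (by omega)))
    (v : Fin n) (hfix : z.foldl (fun v c => μ c v) v = v) (t : ℕ) (ht : t < z.length) :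
    μ z[t] ((z.take ((z.length + 1 - t) % z.length)).foldl (fun v c => μ c v) v) =
      (z.take ((z.length + 1 - (t + 1) % z.length) % z.length)).foldl (fun v c => μ c v) v := by
  set s := (z.length - t) % z.length with hs_def
  have hs : s < z.length := Nat.mod_lt _ (by omega)
  have step := GoodTwin.foldl_take_step μ z v hfix s hs
  rw [sigma_succ ht, sigma_eq_succ ht, ← hs_def, ← step, hsym t ht]
  exact inv_apply_apply μ hinv _ _

/-- **The mirrored trajectory never meets the trajectory** (fixed-point-free letters): if
`v · z.take i = v · z.take (σ i)` for some position `i`, forward determination carries the coincidence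
around the cycle to position `0`, where it reads `v = μ z[0] v`. [folklore] -/
theorem traj_ne_mirror (μ : Fin 3 → Perm (Fin n)) (hinv : ∀ c, μ c * μ c = 1)
    (hfpf : ∀ c v, μ c v ≠ v) (z : List (Fin 3)) (hlen : 2 ≤ z.length)
    (hsym : ∀ t (ht : t < z.length),
      z[t] = z[(z.length - t) % z.length]'(Nat.mod_lt _ (by omega)))
    (v : Fin n) (hfix : z.foldl (fun v c => μ c v) v = v) (i : ℕ) (hi : i < z.length) :
    (z.take i).foldl (fun v c => μ c v) v ≠
      (z.take ((z.length + 1 - i) % z.length)).foldl (fun v c => μ c v) v := by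
  intro h
  have hℓ : 0 < z.length := by omega
  -- propagate the coincidence forward: positions `(i + j) % ℓ`
  have key : ∀ j : ℕ, (z.take ((i + j) % z.length)).foldl (fun v c => μ c v) v =
      (z.take ((z.length + 1 - (i + j) % z.length) % z.length)).foldl (fun v c => μ c v) v := by
    intro j
    induction j with
    | zero => simpa [Nat.mod_eq_of_lt hi] using h
    | succ j ih =>
      have hm : (i + j) % z.length < z.length := Nat.mod_lt _ hℓ
      have e : (i + (j + 1)) % z.length = ((i + j) % z.length + 1) % z.length := by
        rw [← Nat.add_assoc, Nat.mod_add_mod]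
      have h2 := congrArg (μ z[(i + j) % z.length]) ih
      rw [GoodTwin.foldl_take_step μ z v hfix _ hm, mirror_step μ hinv z hlen hsym v hfix _ hm] at h2
      rw [e]
      exact h2
  have h0 := key (z.length - i)
  have e0 : (i + (z.length - i)) % z.length = 0 := by
    rw [show i + (z.length - i) = z.length by omega, Nat.mod_self]
  rw [e0, Nat.sub_zero, Nat.add_mod_left, Nat.mod_eq_of_lt (show 1 < z.length by omega),
    List.take_zero, List.foldl_nil, foldl_take_one μ z hℓ] at h0
  exact hfpf _ _ h0.symm

/-- **Letters of a reflection-form word.**  `z = c :: g ++ c' :: g.reverse` is reflection-symmetric: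
`z[t] = z[(ℓ - t) % ℓ]`. [folklore] -/
theorem reflForm_symm (c c' : Fin 3) (g : List (Fin 3)) (t : ℕ)
    (ht : t < ((c :: g) ++ (c' :: g.reverse)).length) :
    ((c :: g) ++ (c' :: g.reverse))[t] =
      ((c :: g) ++ (c' :: g.reverse))[(((c :: g) ++ (c' :: g.reverse)).length - t) %
        ((c :: g) ++ (c' :: g.reverse)).length]'(Nat.mod_lt _ (by simp)) := by
  set z := (c :: g) ++ (c' :: g.reverse) with hz
  have hL : z.length = g.length + 1 + (g.length + 1) := by
    simp only [hz, List.length_append, List.length_cons, List.length_reverse]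
  have hσ : (z.length - t) % z.length < z.length := Nat.mod_lt _ (by omega)
  -- compare through `getElem?`, where the indices carry no proofs
  have key : z[t]? = z[(z.length - t) % z.length]? := by
    rcases Nat.eq_zero_or_pos t with rfl | hpos
    · simp
    have hmod : (z.length - t) % z.length = z.length - t := Nat.mod_eq_of_lt (by omega)
    rw [hmod, hL]
    rcases Nat.lt_or_ge t (g.length + 1) with h1 | h1
    · -- `t` in the first half `c :: g` (past the axis letter `c`), its mirror in the second half
      obtain ⟨s, rfl⟩ : ∃ s, t = s + 1 := ⟨t - 1, by omega⟩
      have e : g.length + 1 + (g.length + 1) - (s + 1) = (g.length + 1) + ((g.length - 1 - s) + 1) := by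
        omega
      rw [e, hz, List.getElem?_append_left (by simp; omega), List.getElem?_append_right (by simp),
        List.length_cons, Nat.add_sub_cancel_left, List.getElem?_cons_succ, List.getElem?_cons_succ,
        List.getElem?_reverse (by omega)]
      congr 1
      omega
    · rcases Nat.lt_or_ge t (g.length + 2) with h2 | h2
      · -- the axis letter `c'`
        have ht1 : t = g.length + 1 := by omega
        subst ht1
        have e : g.length + 1 + (g.length + 1) - (g.length + 1) = g.length + 1 := by omega
        rw [e]
      · -- `t` in the second half, its mirror in the first half
        rw [hL] at ht
        obtain ⟨s, rfl⟩ : ∃ s, t = (g.length + 1) + (s + 1) := ⟨t - g.length - 2, by omega⟩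
        have e : g.length + 1 + (g.length + 1) - (g.length + 1 + (s + 1)) = (g.length - 1 - s) + 1 := by
          omega
        rw [e, hz, List.getElem?_append_right (by simp), List.length_cons, Nat.add_sub_cancel_left,
          List.getElem?_cons_succ, List.getElem?_reverse (by omega),
          List.getElem?_append_left (by simp; omega), List.getElem?_cons_succ]
  rw [List.getElem?_eq_getElem ht, List.getElem?_eq_getElem hσ] at key
  exact Option.some.inj key

end PatternRefl

open PatternRefl in
/-- **A fixed point with reflection-symmetric pattern gives a clean closed rung walk** (reflection /
loop–path–loop type; companion of the landed `stub_patternTwin`).  Let `μ c` be fixed-point-free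
involutions of `Fin n`, `z` a cyclically reduced colour word of length `ℓ ≥ 2` that is
reflection-symmetric (`z[t] = z[(ℓ - t) % ℓ]`, e.g. `z = c :: g ++ c' :: g.reverse`, `reflForm_symm`), and
`x` a fixed point of `z` whose trajectory avoids `R` and whose self-coincidence pattern is invariant
under the reflection of positions `σ t = (ℓ + 1 - t) % ℓ`.  Then `p t := x · z.take t`,
`q t := x · z.take (σ t)`, `col t := z[t]` on `Fin (k + 1)`, `k + 1 = ℓ`, is clean closed-walk data in
the output format of the core: `p t ≠ q t` (`traj_ne_mirror`), side-preserving steps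
(`GoodTwin.foldl_take_step`, `mirror_step`), cyclically distinct consecutive colours
(`GoodTwin.cyclic_ne`), pairwise equal-or-disjoint rungs (pattern symmetry and `σ ∘ σ = id`), all points
outside `R`. [folklore] -/
theorem patternRefl_cleanWalk (n : ℕ) (μ : Fin 3 → Equiv.Perm (Fin n)) (R : Finset (Fin n))
    (z : List (Fin 3)) (x : Fin n) (hinv : ∀ c, μ c * μ c = 1) (hfpf : ∀ c v, μ c v ≠ v)
    (hlen : 2 ≤ z.length) (hchain : List.IsChain (· ≠ ·) (z ++ z))
    (hsym : ∀ t (ht : t < z.length),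
      z[t] = z[(z.length - t) % z.length]'(Nat.mod_lt _ (by omega)))
    (hfix : z.foldl (fun v c => μ c v) x = x)
    (hpat : ∀ s t : Fin z.length,
      ((z.take (s : ℕ)).foldl (fun v c => μ c v) x = (z.take (t : ℕ)).foldl (fun v c => μ c v) x ↔
        (z.take ((z.length + 1 - s) % z.length)).foldl (fun v c => μ c v) x =
          (z.take ((z.length + 1 - t) % z.length)).foldl (fun v c => μ c v) x))
    (hR : ∀ t : Fin z.length, (z.take (t : ℕ)).foldl (fun v c => μ c v) x ∉ R) :
    ∃ (k : ℕ) (p q : Fin (k + 1) → Fin n) (col : Fin (k + 1) → Fin 3), (∀ i, p i ≠ q i) ∧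
      (∀ i, (μ (col i) (p i) = p (i + 1) ∧ μ (col i) (q i) = q (i + 1)) ∨
        (μ (col i) (p i) = q (i + 1) ∧ μ (col i) (q i) = p (i + 1))) ∧
      (∀ i, col i ≠ col (i + 1)) ∧
      (∀ i j, (p i = p j ∧ q i = q j) ∨ (p i = q j ∧ q i = p j) ∨
        (p i ≠ p j ∧ p i ≠ q j ∧ q i ≠ p j ∧ q i ≠ q j)) ∧
      (∀ i, p i ∉ R ∧ q i ∉ R) ∧ k + 1 = z.length := by
  classical
  obtain ⟨k, hk⟩ : ∃ k, k + 1 = z.length := ⟨z.length - 1, by omega⟩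
  have hlt : ∀ i : Fin (k + 1), (i : ℕ) < z.length := fun i => i.isLt.trans_eq hk
  have hσlt : ∀ i : ℕ, (z.length + 1 - i) % z.length < z.length :=
    fun i => Nat.mod_lt _ (by omega)
  have hval : ∀ i : Fin (k + 1), ((i + 1 : Fin (k + 1)) : ℕ) = ((i : ℕ) + 1) % z.length :=
    fun i => by
      rw [PatternTwin.val_add_one]
      exact congrArg (fun N => ((i : ℕ) + 1) % N) hk
  refine ⟨k, fun i => (z.take i).foldl (fun v c => μ c v) x,
    fun i => (z.take ((z.length + 1 - i) % z.length)).foldl (fun v c => μ c v) x,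
    fun i => z[(i : ℕ)]'(hlt i), ?_, ?_, ?_, ?_, ?_, hk⟩
  · -- the two ends of every rung differ
    intro i
    exact traj_ne_mirror μ hinv hfpf z hlen hsym x hfix i (hlt i)
  · -- the colour `z[t]` maps rung `t` onto rung `t + 1`, side-preservingly
    intro i
    refine Or.inl ⟨?_, ?_⟩
    · show μ (z[(i : ℕ)]'(hlt i)) ((z.take i).foldl (fun v c => μ c v) x) =
        (z.take ((i + 1 : Fin (k + 1)) : ℕ)).foldl (fun v c => μ c v) x
      rw [hval i]
      exact GoodTwin.foldl_take_step μ z x hfix i (hlt i)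
    · show μ (z[(i : ℕ)]'(hlt i))
          ((z.take ((z.length + 1 - i) % z.length)).foldl (fun v c => μ c v) x) =
        (z.take ((z.length + 1 - ((i + 1 : Fin (k + 1)) : ℕ)) % z.length)).foldl
          (fun v c => μ c v) x
      rw [hval i]
      exact mirror_step μ hinv z hlen hsym x hfix i (hlt i)
  · -- consecutive colours differ, cyclically
    intro i
    exact GoodTwin.cyclic_ne hchain i _ (hlt i) (hlt (i + 1)) (hval i)
  · -- rungs are pairwise equal or disjoint
    intro i j
    have hij := hpat ⟨i, hlt i⟩ ⟨j, hlt j⟩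
    have hiσj := hpat ⟨i, hlt i⟩ ⟨(z.length + 1 - j) % z.length, hσlt j⟩
    simp only [sigma_sigma hlen (hlt j)] at hiσj
    by_cases h1 : (z.take i).foldl (fun v c => μ c v) x = (z.take j).foldl (fun v c => μ c v) x
    · exact Or.inl ⟨h1, hij.1 h1⟩
    · by_cases h2 : (z.take i).foldl (fun v c => μ c v) x =
          (z.take ((z.length + 1 - j) % z.length)).foldl (fun v c => μ c v) x
      · exact Or.inr (Or.inl ⟨h2, hiσj.1 h2⟩)
      · exact Or.inr (Or.inr ⟨h1, h2, fun h => h2 (hiσj.2 h), fun h => h1 (hij.2 h)⟩)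
  · -- all points avoid `R`
    intro i
    exact ⟨hR ⟨i, hlt i⟩, hR ⟨_, hσlt i⟩⟩

/-- **Two fixed points with identical patterns and non-crossing trajectories give a clean closed rung
walk** (twin type; the two-point form of the landed `stub_patternTwin`, which finds such a pair inside
any large pattern class by counting).  Let `μ c` be permutations of `Fin n`, `z` a cyclically reduced
colour word of length `ℓ ≥ 2`, and `x, y` fixed points of `z` with identical self-coincidence patterns
whose trajectories avoid `R` and never cross (`x · z.take s ≠ y · z.take t` for all `s, t`).  Then
`p t := x · z.take t`, `q t := y · z.take t`, `col t := z[t]` on `Fin (k + 1)`, `k + 1 = ℓ`, is clean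
closed-walk data in the output format of the core (side-preserving steps, `GoodTwin.foldl_take_step`;
cyclically distinct colours, `GoodTwin.cyclic_ne`; equal rungs exactly at the common self-coincidences,
disjoint otherwise). [folklore] -/
theorem patternPair_cleanWalk (n : ℕ) (μ : Fin 3 → Equiv.Perm (Fin n)) (R : Finset (Fin n))
    (z : List (Fin 3)) (x y : Fin n) (hlen : 2 ≤ z.length) (hchain : List.IsChain (· ≠ ·) (z ++ z))
    (hfx : z.foldl (fun v c => μ c v) x = x) (hfy : z.foldl (fun v c => μ c v) y = y)
    (hpat : ∀ s t : Fin z.length,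
      ((z.take (s : ℕ)).foldl (fun v c => μ c v) x = (z.take (t : ℕ)).foldl (fun v c => μ c v) x ↔
        (z.take (s : ℕ)).foldl (fun v c => μ c v) y = (z.take (t : ℕ)).foldl (fun v c => μ c v) y))
    (hcross : ∀ s t : Fin z.length,
      (z.take (s : ℕ)).foldl (fun v c => μ c v) x ≠ (z.take (t : ℕ)).foldl (fun v c => μ c v) y)
    (hRx : ∀ t : Fin z.length, (z.take (t : ℕ)).foldl (fun v c => μ c v) x ∉ R)
    (hRy : ∀ t : Fin z.length, (z.take (t : ℕ)).foldl (fun v c => μ c v) y ∉ R) :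
    ∃ (k : ℕ) (p q : Fin (k + 1) → Fin n) (col : Fin (k + 1) → Fin 3), (∀ i, p i ≠ q i) ∧
      (∀ i, (μ (col i) (p i) = p (i + 1) ∧ μ (col i) (q i) = q (i + 1)) ∨
        (μ (col i) (p i) = q (i + 1) ∧ μ (col i) (q i) = p (i + 1))) ∧
      (∀ i, col i ≠ col (i + 1)) ∧
      (∀ i j, (p i = p j ∧ q i = q j) ∨ (p i = q j ∧ q i = p j) ∨
        (p i ≠ p j ∧ p i ≠ q j ∧ q i ≠ p j ∧ q i ≠ q j)) ∧
      (∀ i, p i ∉ R ∧ q i ∉ R) ∧ k + 1 = z.length := by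
  classical
  obtain ⟨k, hk⟩ : ∃ k, k + 1 = z.length := ⟨z.length - 1, by omega⟩
  have hlt : ∀ i : Fin (k + 1), (i : ℕ) < z.length := fun i => i.isLt.trans_eq hk
  have hval : ∀ i : Fin (k + 1), ((i + 1 : Fin (k + 1)) : ℕ) = ((i : ℕ) + 1) % z.length :=
    fun i => by
      rw [PatternTwin.val_add_one]
      exact congrArg (fun N => ((i : ℕ) + 1) % N) hk
  refine ⟨k, fun i => (z.take i).foldl (fun v c => μ c v) x,
    fun i => (z.take i).foldl (fun v c => μ c v) y, fun i => z[(i : ℕ)]'(hlt i),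
    ?_, ?_, ?_, ?_, ?_, hk⟩
  · -- the two ends of every rung differ: no crossing at `s = t`
    intro i
    exact hcross ⟨i, hlt i⟩ ⟨i, hlt i⟩
  · -- side-preserving steps on both trajectories
    intro i
    refine Or.inl ⟨?_, ?_⟩
    · show μ (z[(i : ℕ)]'(hlt i)) ((z.take i).foldl (fun v c => μ c v) x) =
        (z.take ((i + 1 : Fin (k + 1)) : ℕ)).foldl (fun v c => μ c v) x
      rw [hval i]
      exact GoodTwin.foldl_take_step μ z x hfx i (hlt i)
    · show μ (z[(i : ℕ)]'(hlt i)) ((z.take i).foldl (fun v c => μ c v) y) =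
        (z.take ((i + 1 : Fin (k + 1)) : ℕ)).foldl (fun v c => μ c v) y
      rw [hval i]
      exact GoodTwin.foldl_take_step μ z y hfy i (hlt i)
  · -- consecutive colours differ, cyclically
    intro i
    exact GoodTwin.cyclic_ne hchain i _ (hlt i) (hlt (i + 1)) (hval i)
  · -- rungs are pairwise equal or disjoint
    intro i j
    have hij := hpat ⟨i, hlt i⟩ ⟨j, hlt j⟩
    by_cases h1 : (z.take i).foldl (fun v c => μ c v) x = (z.take j).foldl (fun v c => μ c v) x
    · exact Or.inl ⟨h1, hij.1 h1⟩
    · exact Or.inr (Or.inr ⟨h1, hcross ⟨i, hlt i⟩ ⟨j, hlt j⟩,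
        fun h => hcross ⟨j, hlt j⟩ ⟨i, hlt i⟩ h.symm, fun h => h1 (hij.2 h)⟩)
  · -- both trajectories avoid `R`
    intro i
    exact ⟨hRx ⟨i, hlt i⟩, hRy ⟨i, hlt i⟩⟩

/-- **Registered form `stub_patternRefl`** (crux `stmt-MatrixMultiplication-10883`, helper stub of siege seat
k20): `patternRefl_cleanWalk` for a word given in reflection form `z = a :: g ++ b :: g.reverse`
(`reflForm_symm`). [folklore] -/
theorem stub_patternRefl : ∀ (n : ℕ) (μ : Fin 3 → Equiv.Perm (Fin n)) (R : Finset (Fin n)) (a b : Fin 3) (g z : List (Fin 3)) (x : Fin n), (∀ c, μ c * μ c = 1) → (∀ c v, μ c v ≠ v) → z = a :: g ++ b :: g.reverse → List.IsChain (· ≠ ·) (z ++ z) → z.foldl (fun v c => μ c v) x = x → (∀ s t : Fin z.length, ((z.take (s : ℕ)).foldl (fun v c => μ c v) x = (z.take (t : ℕ)).foldl (fun v c => μ c v) x ↔ (z.take ((z.length + 1 - s) % z.length)).foldl (fun v c => μ c v) x = (z.take ((z.length + 1 - t) % z.length)).foldl (fun v c => μ c v) x)) → (∀ t : Fin z.length,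 (z.take (t : ℕ)).foldl (fun v c => μ c v) x ∉ R) → ∃ (k : ℕ) (p q : Fin (k + 1) → Fin n) (col : Fin (k + 1) → Fin 3), (∀ i, p i ≠ q i) ∧ (∀ i, (μ (col i) (p i) = p (i + 1) ∧ μ (col i) (q i) = q (i + 1)) ∨ (μ (col i) (p i) = q (i + 1) ∧ μ (col i) (q i) = p (i + 1))) ∧ (∀ i, col i ≠ col (i + 1)) ∧ (∀ i j, (p i = p j ∧ q i = q j) ∨ (p i = q j ∧ q i = p j) ∨ (p i ≠ p j ∧ p i ≠ q j ∧ q i ≠ p j ∧ q i ≠ q j)) ∧ (∀ i, p i ∉ R ∧ q i ∉ R) ∧ k + 1 = z.length := by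
  intro n μ R a b g z x hinv hfpf hz hchain hfix hpat hR
  have hlen : 2 ≤ z.length := by
    simp only [hz, List.length_append, List.length_cons, List.length_reverse]; omega
  have hsym : ∀ t (ht : t < z.length),
      z[t] = z[(z.length - t) % z.length]'(Nat.mod_lt _ (by omega)) := by
    subst hz
    intro t ht
    exact PatternRefl.reflForm_symm a b g t ht
  exact patternRefl_cleanWalk n μ R z x hinv hfpf hlen hchain hsym hfix hpat hR

/-- **Registered form `stub_patternPair`** (crux `stmt-MatrixMultiplication-10883`, helper stub of siege seat
k20): `patternPair_cleanWalk` verbatim. [folklore] -/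
theorem stub_patternPair : ∀ (n : ℕ) (μ : Fin 3 → Equiv.Perm (Fin n)) (R : Finset (Fin n)) (z : List (Fin 3)) (x y : Fin n), 2 ≤ z.length → List.IsChain (· ≠ ·) (z ++ z) → z.foldl (fun v c => μ c v) x = x → z.foldl (fun v c => μ c v) y = y → (∀ s t : Fin z.length, ((z.take (s : ℕ)).foldl (fun v c => μ c v) x = (z.take (t : ℕ)).foldl (fun v c => μ c v) x ↔ (z.take (s : ℕ)).foldl (fun v c => μ c v) y = (z.take (t : ℕ)).foldl (fun v c => μ c v) y)) → (∀ s t : Fin z.length, (z.take (s : ℕ)).foldl (fun v c => μ c v) x ≠ (z.take (t : ℕ)).foldl (fun v c => μ c v) y) → (∀ t : Fin z.length, (z.take (t : ℕ)).foldl (fun v c => μ c v) x ∉ R) → (∀ t : Fin z.length, (z.take (t : ℕ)).foldl (fun v c => μ c v) y ∉ R) → ∃ (k : ℕ) (p q : Fin (k + 1) → Fin n) (col : Fin (k + 1) → Fin 3), (∀ i, p i ≠ q i) ∧ (∀ i, (μ (col i) (p i) = p (i + 1) ∧ μ (col i) (q i) = q (i + 1)) ∨ (μ (col i) (p i) = q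 (i + 1) ∧ μ (col i) (q i) = p (i + 1))) ∧ (∀ i, col i ≠ col (i + 1)) ∧ (∀ i j, (p i = p j ∧ q i = q j) ∨ (p i = q j ∧ q i = p j) ∨ (p i ≠ p j ∧ p i ≠ q j ∧ q i ≠ p j ∧ q i ≠ q j)) ∧ (∀ i, p i ∉ R ∧ q i ∉ R) ∧ k + 1 = z.length :=
  patternPair_cleanWalk

end Summit.MatrixMultiplication.MatrixMultiplication.Theorems.HyperoctahedralThreshold
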